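import Summits.QuantumFields.BalabanUV.T4Continuum.Support.NE3CombGaugeCharge
import Literature.MathematicalPhysics.QuantumFieldTheory.Balaban1983to89.B8Ineq129
import HarnessLib

/-!
# T⁴ programme, node NE3 — row E-MLw-(w4)P, sub-row C0, file 3: THE `κ`-FIRST COMB OF A LINE OF BLOCKS — exact face
# compatibility with the straight transport, and bond bounds uniform along the line

NE3 (node U1b) formalisation swarm `b2b-balaban-t4-ne3-formalise-*`, leaf seat `b2b-balaban-t4-ne3-formalise-leaf-01`
(gen 5), row **C0** of the owner's design `HOME/t4/b2b-balaban-t4-ne3-p1/g21/D-ne3p1-g21-1.md` §3–§4; this file answers FINDING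
F-ne3leaf01g5-1 (`HOME/CLAIMS.log`, 2026-08-20 ≈15:23Z).  Files 1–2 = `NE3CombGauge` / `NE3CombGaugeCharge` (standard comb `btree`).

WHY.  The design's step (C4a) identifies the face jump `Jmp(D_U μ)` with `M²·`(face part of the covariant derivative of the
comb-transported corner charge `Φ_W`).  At a face-crossing `κ`-bond `(x, x+e_κ)` between the blocks `z` and `z′ = z + e_κ` this
requires the FACE TRANSPORT `u_z(x)·W(x,κ)·u_{z′}(x+e_κ)⁻¹` to be the coarse bond variable `U(z,κ)` up to a comb-size defect,
INDEPENDENTLY of the face site `x`.  For the standard comb (B5 order, direction `d−1` first) this holds only for `κ = d−1`.  THIS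
FILE builds the `κ`-FIRST comb: walk the `κ`-coordinate first, then the standard tree on the transverse part,
`lineWord κ v = seg κ (v κ) ++ treeWord (v − (v κ)•e_κ)`, `lcomb κ M W z y = W(q_z; lineWord κ (y − q_z))`, `q_z = M•z`.  Then
(all [folklore], 0 sorry):

§1 word algebra: `disp (lineWord κ v) = v`; splitting off an initial `κ`-segment;
§2 `lcomb = (κ-segment) · axialFn` and **LINE COMPATIBILITY, EXACT, EVERY `κ`**: `lcomb κ M W z y = bseg M W z κ · lcomb κ M W (z+e_κ) y`
   whenever `(y − q_z)_κ ≥ M` (`bseg` = the straight `M`-segment transport of row NE3-R2's `AveragingDeficitBlockDensity`);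
§3 THE BOND IDENTITIES: for `μ ≠ κ`, `W^{lcomb}(x,μ) = S·W^{axialFn W p}(x,μ)·S⁻¹` (`S` the `κ`-segment to `p`); for `μ = κ`,
   `W^{lcomb}(x,κ) = S·W(p; ladder (treeWord w) κ)·S⁻¹` (B7's LADDER over the transverse tree word `w`);
§4 THE BOND BOUNDS, UNIFORM ALONG THE `κ`-LINE: `‖W^{lcomb}(x,μ) − 1‖ ≤ |transverse part of x − q_z|₁ · a ≤ (d−1)(M−1)·a` for EVERY
   `x ≥ q_z` with transverse residues `< M` — WHATEVER its `κ`-coordinate (B8's `axial_bond_bound_sharp` / B7's `ladder_bound_local`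
   BY NAME, `B8Ineq129.l1_lowPart_le`); unitary, small-field, corner, charge and defect-functional corollaries (the generic §6–§7 of file 2 apply verbatim);
§5 THE FACE TRANSPORT: `lcomb_z(x)·W(x,κ)·lcomb_{z′}(x+e_κ)⁻¹ = W^{lcomb_z}(x,κ) · bseg M W z κ` EXACTLY at face sites, hence the
   face part of `gaugeDir W Φ` EQUALS the transported coarse gauge direction `gaugeDir (bseg M W) μ (z,κ)` of the STRAIGHT-TRANSPORT
   coarse configuration plus a comb-loop defect `≤ 2(d−1)(M−1)a·‖μ z‖` — the exact form of (C4a) with `U := bseg M W`.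

HONEST FRAMING.  Kinematics/algebra of B7 p. 24 on our lattice objects ([folklore]; context [Balaban1985Averaging] (8) p. 18,
p. 24–25, (42) p. 23); a DESIGN input (which coarse `U` makes (C4a) exact), no estimate of NE3's; nothing about Bałaban's
minimisers; (P_W), (ML_w), T-E_w, (μK) and **NE3 are NOT proved**; spine PROVED 0∕9; finite T⁴ rung (B)+1 — NOT infinite volume,
NOT mass gap, NOT `BetaPertH`, NOT Clay.  PLACEMENT: `Summits/QuantumFields/BalabanUV/`; imports file 2 BY NAME (DATA defs
`lineWord`, `lcomb` → async audit; no `def … : Prop`).  HONEST DEPENDENCY (cell page 1): continuum YM on T⁴ ⇐ BetaPertH ∧ nine spine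
estimates (0/9 proved); BetaPertH ⇐ (D1) ∧ (D4) ∧ CAP+tail; G-an2-4 gates asym, D1 and NE2/3/4.
-/

set_option autoImplicit false

open scoped BigOperators Matrix Matrix.Norms.L2Operator
open NormedSpace Finset

namespace Summit.QuantumFields.BalabanUV.T4Continuum.NE3CombGaugeLine

open Literature.MathematicalPhysics.QuantumFieldTheory.Balaban1983to89
open B7Prop1Explicit B7Prop2Explicit MatrixLog
open B8Lemma1NonAbelian (lowPart lowPart_apply lowPart_nonneg lowPart_le_self l1_lowPart_eq PlaqSmall axial_bond_bound_sharp
  axial_treeBond_eq_one ladder_bound_local forward_of_mem_treeWord ne_zero_of_mem_treeWord zsmul_e_nonneg)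
open T4AveragingDeficitWall (IsUnitaryCfg SmallField Ad)
open T4AveragingDeficitNonAbelian (Ad_mul Ad_sub)
open AveragingDeficitNearIdentity (Ad_one norm_Ad_sub_le)
open AveragingDeficitTransport (norm_Ad_of_unitary mem_U1_of_unitary)
open AveragingDeficitBlockDensity (bseg bseg_mem)
open SpreadLiftDirection (isUnitaryCfg_gaugeAct')
open BlockAveragePushDirGauge (gaugeDir)
open NE3CombGauge (plaqSmall_of_smallField sum_ite_lt_le)
open NE3CombGaugeCharge (gaugeDir_Ad_inv_eq norm_gaugeDir_Ad_inv_le norm_sum_Ad_inv_sub_le)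

noncomputable section

variable {d : ℕ} {n : Type*} [Fintype n] [DecidableEq n]

/-! ## §1 The `κ`-first comb word -/

/-- THE `κ`-FIRST COMB WORD from the corner to `v`: the `κ`-segment of length `v κ` first, then the standard tree contour
(B5 (1.7) order) on the transverse part `v − (v κ)•e_κ`. [folklore] -/
def lineWord (κ : Fin d) (v : Site d) : List (Letter d) := seg κ (v κ) ++ treeWord (v - v κ • e κ)

/-- The transverse part has vanishing `κ`-coordinate. [folklore] -/
theorem transverse_apply_self (κ : Fin d) (v : Site d) : (v - v κ • e κ) κ = 0 := by
  simp [e_apply]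

/-- The transverse part agrees with `v` off `κ`. [folklore] -/
theorem transverse_apply_ne (κ : Fin d) (v : Site d) {j : Fin d} (h : j ≠ κ) : (v - v κ • e κ) j = v j := by
  simp [e_apply, h]

/-- `lineWord κ v` ends at `v`. [folklore] -/
theorem disp_lineWord (κ : Fin d) (v : Site d) : disp (lineWord κ v) = v := by
  rw [lineWord, disp_append, disp_seg, disp_treeWord, add_sub_cancel]

/-- Segments of natural lengths concatenate. [folklore] -/
theorem seg_natCast_add (κ : Fin d) (s t : ℕ) : seg κ ((s : ℤ) + (t : ℤ)) = seg κ s ++ seg κ t := by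
  rw [← Nat.cast_add, seg_natCast, seg_natCast, seg_natCast, List.replicate_add]

/-- **Splitting off an initial `κ`-segment**: if `v κ = s + t` with `s, t ∈ ℕ`, then
`lineWord κ v = seg κ s ++ lineWord κ (v − s•e_κ)` (the transverse part is unchanged). [folklore] -/
theorem lineWord_split (κ : Fin d) (v : Site d) (s t : ℕ) (hv : v κ = (s : ℤ) + (t : ℤ)) :
    lineWord κ v = seg κ s ++ lineWord κ (v - (s : ℤ) • e κ) := by
  have h1 : (v - (s : ℤ) • e κ) κ = (t : ℤ) := by simp [e_apply, hv]
  have h2 : v - (s : ℤ) • e κ - (t : ℤ) • e κ = v - v κ • e κ := by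
    rw [hv, add_smul]; abel
  rw [lineWord, lineWord, h1, h2, hv, seg_natCast_add, List.append_assoc]

/-! ## §2 The `κ`-first comb transport of a block: factorisation and line compatibility -/

/-- THE `κ`-FIRST COMB TRANSPORT of the block of `z` at scale `M`: `lcomb κ M W z y = W(M•z; lineWord κ (y − M•z))`, defined for
every site `y` (used on the `κ`-line of blocks `z, z + e_κ, …`). [cite: Balaban1985Averaging, p.24] -/
def lcomb (κ : Fin d) (M : ℕ) (W : Site d → Fin d → (Matrix n n ℂ)ˣ) (z y : Site d) : (Matrix n n ℂ)ˣ :=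
  hol W ((M : ℤ) • z) (lineWord κ (y - (M : ℤ) • z))

/-- **FACTORISATION**: `lcomb = (κ-segment to p) · (standard axial transport from p)`, `p = q + (y − q)_κ • e_κ`, `q = M•z`.
[folklore] -/
theorem lcomb_eq_seg_mul_axialFn (κ : Fin d) (M : ℕ) (W : Site d → Fin d → (Matrix n n ℂ)ˣ) (z y : Site d) :
    lcomb κ M W z y = hol W ((M : ℤ) • z) (seg κ ((y - (M : ℤ) • z) κ))
      * axialFn W ((M : ℤ) • z + (y - (M : ℤ) • z) κ • e κ) y := by
  rw [lcomb, lineWord, hol_append, disp_seg, axialFn]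
  congr 2
  abel

/-- At the corner the transport is `1`. [folklore] -/
theorem lcomb_corner (κ : Fin d) (M : ℕ) (W : Site d → Fin d → (Matrix n n ℂ)ˣ) (z : Site d) :
    lcomb κ M W z ((M : ℤ) • z) = 1 := by
  simp [lcomb, lineWord]

/-- `lcomb` of `U(N)` data is unitary. [folklore] -/
theorem lcomb_mem {W : Site d → Fin d → (Matrix n n ℂ)ˣ} (hW : IsUnitaryCfg W) (κ : Fin d) (M : ℕ) (z y : Site d) :
    lcomb κ M W z y ∈ unitaryUnits (Matrix n n ℂ) := hol_mem_of hW _ _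

/-- **LINE COMPATIBILITY (exact, every direction)**: beyond the `κ`-face the comb of block `z` IS the straight `M`-segment followed
by the comb of the next block: `lcomb κ M W z y = bseg M W z κ · lcomb κ M W (z + e_κ) y` whenever `(y − M•z)_κ ≥ M`.
[cite: Balaban1985Averaging, (42) p.23, p.24] -/
theorem lcomb_eq_bseg_mul_lcomb (κ : Fin d) (M : ℕ) (W : Site d → Fin d → (Matrix n n ℂ)ˣ) (z : Site d) {y : Site d}
    (hy : (M : ℤ) ≤ (y - (M : ℤ) • z) κ) :
    lcomb κ M W z y = bseg M W z κ * lcomb κ M W (z + e κ) y := by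
  obtain ⟨t, ht⟩ := Int.eq_ofNat_of_zero_le (sub_nonneg.mpr hy)
  have hv : (y - (M : ℤ) • z) κ = (M : ℤ) + (t : ℤ) := by linarith
  rw [lcomb, lineWord_split κ _ M t hv, hol_append, disp_seg, lcomb, bseg]
  congr 2
  · rw [smul_add]
  · rw [smul_add]; abel

/-- … iterated along the `κ`-line: `lcomb κ M W z y = W(M•z; seg κ (s·M)) · lcomb κ M W (z + s•e_κ) y` for `(y − M•z)_κ ≥ s·M`.
[folklore] -/
theorem lcomb_eq_seg_mul_lcomb (κ : Fin d) (M : ℕ) (W : Site d → Fin d → (Matrix n n ℂ)ˣ) (z : Site d) :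
    ∀ (s : ℕ) {y : Site d}, ((s * M : ℕ) : ℤ) ≤ (y - (M : ℤ) • z) κ →
      lcomb κ M W z y = hol W ((M : ℤ) • z) (seg κ ((s * M : ℕ) : ℤ)) * lcomb κ M W (z + (s : ℤ) • e κ) y
  | 0, y, _ => by simp
  | s + 1, y, hy => by
    have hy' : ((s * M : ℕ) : ℤ) ≤ (y - (M : ℤ) • z) κ := by push_cast at hy ⊢; nlinarith
    have hM : (M : ℤ) ≤ (y - (M : ℤ) • (z + (s : ℤ) • e κ)) κ := by
      have : (y - (M : ℤ) • (z + (s : ℤ) • e κ)) κ = (y - (M : ℤ) • z) κ - s * M := by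
        simp [e_apply, smul_add]; ring
      rw [this]; push_cast at hy; nlinarith
    rw [lcomb_eq_seg_mul_lcomb κ M W z s hy', lcomb_eq_bseg_mul_lcomb κ M W _ hM, ← mul_assoc, bseg,
      show (((s + 1) * M : ℕ) : ℤ) = ((s * M : ℕ) : ℤ) + (M : ℤ) by push_cast; ring, seg_natCast_add, hol_append, disp_seg]
    congr 2
    · push_cast; rw [smul_add, smul_smul]; congr 2; ring
    · push_cast; rw [add_smul, one_smul, add_assoc]

/-! ## §3 The bond identities of the `κ`-first comb gauge -/

/-- **`μ ≠ κ`: CONJUGATE OF THE STANDARD AXIAL BOND AT THE SHIFTED BASE**: with `q = M•z`, `t = (x − q)_κ`, `p = q + t•e_κ`,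
`S = W(q; seg κ t)`: `W^{lcomb}(x, μ) = S · W^{axialFn W p}(x, μ) · S⁻¹`. [cite: Balaban1985Averaging, (8) p.18, p.24] -/
theorem gaugeAct_lcomb_of_ne (κ : Fin d) (M : ℕ) (W : Site d → Fin d → (Matrix n n ℂ)ˣ) (z x : Site d) {μ : Fin d}
    (hμ : μ ≠ κ) :
    gaugeAct (lcomb κ M W z) W x μ
      = hol W ((M : ℤ) • z) (seg κ ((x - (M : ℤ) • z) κ))
        * gaugeAct (axialFn W ((M : ℤ) • z + (x - (M : ℤ) • z) κ • e κ)) W x μ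
        * (hol W ((M : ℤ) • z) (seg κ ((x - (M : ℤ) • z) κ)))⁻¹ := by
  have hκ : (x + e μ - (M : ℤ) • z) κ = (x - (M : ℤ) • z) κ := by
    simp [e_apply, (Ne.symm hμ)]
  unfold gaugeAct
  rw [lcomb_eq_seg_mul_axialFn, lcomb_eq_seg_mul_axialFn, hκ]
  simp only [mul_inv_rev, mul_assoc]

/-- **`μ = κ`: CONJUGATE OF B7's LADDER over the transverse tree word**: with `w = x − p` the transverse part,
`W^{lcomb}(x, κ) = S · W(p; ladder (treeWord w) κ) · S⁻¹`. [cite: Balaban1985Averaging, pp.24–25] -/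
theorem gaugeAct_lcomb_self (κ : Fin d) (M : ℕ) (W : Site d → Fin d → (Matrix n n ℂ)ˣ) (z x : Site d) :
    gaugeAct (lcomb κ M W z) W x κ
      = hol W ((M : ℤ) • z) (seg κ ((x - (M : ℤ) • z) κ))
        * hol W ((M : ℤ) • z + (x - (M : ℤ) • z) κ • e κ)
            (ladder (treeWord (x - ((M : ℤ) • z + (x - (M : ℤ) • z) κ • e κ))) κ)
        * (hol W ((M : ℤ) • z) (seg κ ((x - (M : ℤ) • z) κ)))⁻¹ := by
  set q : Site d := (M : ℤ) • z with hq
  set t : ℤ := (x - q) κ with ht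
  set p : Site d := q + t • e κ with hp
  have hκ : (x + e κ - q) κ = t + 1 := by simp [ht, e_apply]; ring
  have hpe : q + (t + 1) • e κ = p + e κ := by rw [hp, add_smul, one_smul, add_assoc]
  have hw : x + e κ - (p + e κ) = x - p := by abel
  have hpx : p + (x - p) = x := by abel
  unfold gaugeAct
  rw [lcomb_eq_seg_mul_axialFn, lcomb_eq_seg_mul_axialFn, ← hq, ← ht, hκ, hol_seg_succ, hpe, ← hp]
  simp only [axialFn]
  rw [hw, hol_ladder, disp_treeWord, hpx]
  simp only [mul_inv_rev, mul_assoc]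

/-! ## §4 The bond bounds, uniform along the `κ`-line -/

/-- A transverse vector (`w κ = 0`) with coordinates in `[0, M−1]` has `|w|₁ ≤ (d−1)(M−1)`. [folklore] -/
theorem l1_transverse_le (κ : Fin d) {M : ℕ} (hM : 1 ≤ M) {w : Site d} (hw0 : 0 ≤ w) (hwκ : w κ = 0)
    (hw : ∀ j, j ≠ κ → w j ≤ (M : ℤ) - 1) :
    (l1 w : ℝ) ≤ ((d : ℝ) - 1) * ((M : ℝ) - 1) := by
  have hM' : (0 : ℝ) ≤ (M : ℝ) - 1 := by
    have : (1 : ℝ) ≤ M := by exact_mod_cast hM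
    linarith
  have hκu : κ ∈ (univ : Finset (Fin d)) := mem_univ κ
  unfold l1
  push_cast
  rw [← add_sum_erase _ _ hκu, hwκ]
  simp only [Int.natAbs_zero, Nat.cast_zero, zero_add]
  calc ∑ j ∈ univ.erase κ, ((w j).natAbs : ℝ) ≤ ∑ _j ∈ univ.erase κ, ((M : ℝ) - 1) := by
        refine sum_le_sum fun j hj => ?_
        have hjκ : j ≠ κ := ne_of_mem_erase hj
        have h1 := hw j hjκ; have h2 : 0 ≤ w j := hw0 j
        rw [Nat.cast_natAbs, Int.cast_abs, abs_of_nonneg (by exact_mod_cast h2)]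
        exact_mod_cast h1
    _ = ((d : ℝ) - 1) * ((M : ℝ) - 1) := by
        rw [sum_const, card_erase_of_mem hκu, card_univ, Fintype.card_fin, nsmul_eq_mul]
        have hd : 1 ≤ d := Fin.pos κ
        push_cast [Nat.cast_sub hd]; ring

section Small

variable [Nonempty n] {M : ℕ} {W : Site d → Fin d → (Matrix n n ℂ)ˣ} (hW : IsUnitaryCfg W) {a : ℝ} (hWa : SmallField W a)
include hW hWa

/-- **THE BOND BOUND, `μ ≠ κ`**: for `M•z ≤ x`, `‖W^{lcomb}(x, μ) − 1‖ ≤ |lowPart μ (x − p)|₁ · a`, `p = M•z + (x − M•z)_κ•e_κ`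
(the transverse part only — the `κ`-coordinate of `x` does not enter). [cite: Balaban1985Averaging, pp.24–25] -/
theorem norm_lcombGauge_sub_one_le_of_ne (κ : Fin d) (z : Site d) {x : Site d} (hx : (M : ℤ) • z ≤ x) {μ : Fin d} (hμ : μ ≠ κ) :
    ‖((gaugeAct (lcomb κ M W z) W x μ : (Matrix n n ℂ)ˣ) : Matrix n n ℂ) - 1‖
      ≤ l1 (lowPart μ (x - ((M : ℤ) • z + (x - (M : ℤ) • z) κ • e κ))) * a := by
  have hW1 : ∀ y ν, W y ν ∈ U1 (Matrix n n ℂ) := fun y ν => mem_U1_of_unitary (hW y ν)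
  set p : Site d := (M : ℤ) • z + (x - (M : ℤ) • z) κ • e κ with hp
  have hpx : p ≤ x := by
    intro j; rw [hp]; by_cases hj : j = κ
    · subst hj; simp [e_apply]
    · have := hx j; simp only [Pi.add_apply, Pi.smul_apply, e_apply, if_neg hj, smul_eq_mul, mul_zero, add_zero]; exact this
  rw [gaugeAct_lcomb_of_ne κ M W z x hμ, Units.val_mul, Units.val_mul]
  refine (norm_units_conj_sub_one_le (hol_mem hW1 _ _) _).trans ?_
  exact axial_bond_bound_sharp W hW1 (plaqSmall_of_smallField hWa p (x + e μ)) p x μ le_rfl hpx le_rfl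

/-- **THE BOND BOUND, `μ = κ`**: for `M•z ≤ x`, `‖W^{lcomb}(x, κ) − 1‖ ≤ |x − p|₁ · a` (the LADDER over the transverse tree word,
B7's non-abelian Stokes `ladder_bound_local` with the plaquette bounds read directly from `SmallField`). [cite: Balaban1985Averaging, pp.24–25] -/
theorem norm_lcombGauge_sub_one_le_self (κ : Fin d) (z : Site d) {x : Site d} (hx : (M : ℤ) • z ≤ x) :
    ‖((gaugeAct (lcomb κ M W z) W x κ : (Matrix n n ℂ)ˣ) : Matrix n n ℂ) - 1‖
      ≤ l1 (x - ((M : ℤ) • z + (x - (M : ℤ) • z) κ • e κ)) * a := by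
  have hW1 : ∀ y ν, W y ν ∈ U1 (Matrix n n ℂ) := fun y ν => mem_U1_of_unitary (hW y ν)
  set p : Site d := (M : ℤ) • z + (x - (M : ℤ) • z) κ • e κ with hp
  set w : Site d := x - p with hw
  have hw0 : 0 ≤ w := by
    intro j; rw [hw, hp]; by_cases hj : j = κ
    · subst hj; simp [e_apply]
    · have := hx j
      simp only [Pi.sub_apply, Pi.add_apply, Pi.smul_apply, e_apply, if_neg hj, smul_eq_mul, mul_zero, add_zero, Pi.zero_apply,
        sub_nonneg]
      exact this
  have hwκ : w κ = 0 := by rw [hw, hp]; simp [e_apply]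
  rw [gaugeAct_lcomb_self κ M W z x, Units.val_mul, Units.val_mul]
  refine (norm_units_conj_sub_one_le (hol_mem hW1 _ _) _).trans ?_
  have hQ : ∀ l ∈ treeWord w, l.1 ≠ κ := fun l hl h => ne_zero_of_mem_treeWord hl (h ▸ hwκ)
  have hlad := ladder_bound_local W hW1 κ (treeWord w) p hQ (fun w₁ w₂ l hsplit => by
    have hl : l ∈ treeWord w := by rw [hsplit]; simp
    rw [forward_of_mem_treeWord hw0 hl, lplaqWord_true]
    exact hWa _ _ _ (hQ l hl))
  rw [length_treeWord] at hlad
  rw [← hw]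
  exact hlad

/-- **THE BOND BOUND, UNIFORM ALONG THE `κ`-LINE OF BLOCKS**: for `M•z ≤ x` with transverse residues `(x − M•z)_j ≤ M−1` (`j ≠ κ`)
and ANY `κ`-coordinate, `‖W^{lcomb}(x, μ) − 1‖ ≤ (d−1)(M−1)·a` for every direction `μ` — the owner's constant on the double
block and on whole `κ`-lines of blocks. [cite: Balaban1985Averaging, pp.24–25] -/
theorem norm_lcombGauge_sub_one_le (hM : 1 ≤ M) (ha : 0 ≤ a) (κ : Fin d) (z : Site d) {x : Site d} (hx : (M : ℤ) • z ≤ x)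
    (hxt : ∀ j, j ≠ κ → (x - (M : ℤ) • z) j ≤ (M : ℤ) - 1) (μ : Fin d) :
    ‖((gaugeAct (lcomb κ M W z) W x μ : (Matrix n n ℂ)ˣ) : Matrix n n ℂ) - 1‖ ≤ ((d : ℝ) - 1) * ((M : ℝ) - 1) * a := by
  set w : Site d := x - ((M : ℤ) • z + (x - (M : ℤ) • z) κ • e κ) with hw
  have hw0 : 0 ≤ w := by
    intro j; rw [hw]; by_cases hj : j = κ
    · subst hj; simp [e_apply]
    · have := hx j
      simp only [Pi.sub_apply, Pi.add_apply, Pi.smul_apply, e_apply, if_neg hj, smul_eq_mul, mul_zero, add_zero, Pi.zero_apply,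
        sub_nonneg]
      exact this
  have hwκ : w κ = 0 := by rw [hw]; simp [e_apply]
  have hwj : ∀ j, j ≠ κ → w j ≤ (M : ℤ) - 1 := by
    intro j hj; have := hxt j hj
    rw [hw]; simp only [Pi.sub_apply, Pi.add_apply, Pi.smul_apply, e_apply, if_neg hj, smul_eq_mul, mul_zero, add_zero]
    simpa using this
  have hl1 : (l1 w : ℝ) ≤ ((d : ℝ) - 1) * ((M : ℝ) - 1) := l1_transverse_le κ hM hw0 hwκ hwj
  by_cases hμ : μ = κ
  · subst hμ
    refine (norm_lcombGauge_sub_one_le_self hW hWa μ z hx).trans ?_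
    rw [← hw]; exact mul_le_mul_of_nonneg_right hl1 ha
  · refine (norm_lcombGauge_sub_one_le_of_ne hW hWa κ z hx hμ).trans ?_
    rw [← hw]
    refine mul_le_mul_of_nonneg_right (le_trans ?_ hl1) ha
    exact_mod_cast B8Ineq129.l1_lowPart_le μ w

omit [Nonempty n] hWa in
/-- The `κ`-first comb gauge is unitary. [folklore] -/
theorem isUnitaryCfg_lcombGauge (κ : Fin d) (z : Site d) : IsUnitaryCfg (gaugeAct (lcomb κ M W z) W) :=
  isUnitaryCfg_gaugeAct' (fun y => lcomb_mem hW κ M z y) hW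

/-- … and stays in the small-field class. [cite: Balaban1985Averaging, (44)–(45) p.24] -/
theorem smallField_lcombGauge (κ : Fin d) (z : Site d) : SmallField (gaugeAct (lcomb κ M W z) W) a := by
  intro x ν ν' hne
  rw [hol_gaugeAct_closed _ _ _ _ (disp_plaqWord ν ν'), Units.val_mul, Units.val_mul]
  exact (norm_units_conj_sub_one_le (mem_U1_of_unitary (lcomb_mem hW κ M z x)) _).trans (hWa x ν ν' hne)

/-- **THE COMB-TRANSPORTED CORNER CHARGE along the line**: `‖gaugeDir W (Ad_{lcomb(·)⁻¹} m) (x, μ)‖ ≤ 2(d−1)(M−1)a·‖m‖` under the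
hypotheses of `norm_lcombGauge_sub_one_le` (file 2's `norm_gaugeDir_Ad_inv_le`, generic in the gauge). [folklore] -/
theorem norm_gaugeDir_lcombCharge_le (hM : 1 ≤ M) (ha : 0 ≤ a) (κ : Fin d) (z : Site d) (m : Matrix n n ℂ) {x : Site d}
    (hx : (M : ℤ) • z ≤ x) (hxt : ∀ j, j ≠ κ → (x - (M : ℤ) • z) j ≤ (M : ℤ) - 1) (μ : Fin d) :
    ‖gaugeDir W (fun y => Ad (lcomb κ M W z y)⁻¹ m) x μ‖ ≤ 2 * (((d : ℝ) - 1) * ((M : ℝ) - 1) * a) * ‖m‖ := by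
  refine (norm_gaugeDir_Ad_inv_le hW (fun y => lcomb_mem hW κ M z y) m x μ).trans ?_
  gcongr
  exact norm_lcombGauge_sub_one_le hW hWa hM ha κ z hx hxt μ

/-- **THE DEFECT FUNCTIONAL along the line**: for a finite set `F` of bonds whose initial points satisfy the hypotheses of
`norm_lcombGauge_sub_one_le`, `‖Σ_{b∈F}(Ad_{W^{lcomb}(b)⁻¹}(Y b) − Y b)‖ ≤ 2(d−1)(M−1)a·Σ_{b∈F}‖Y b‖`. [folklore] -/
theorem norm_sum_lcombDefect_le (hM : 1 ≤ M) (ha : 0 ≤ a) (κ : Fin d) (z : Site d) (F : Finset (Site d × Fin d))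
    (hF : ∀ b ∈ F, (M : ℤ) • z ≤ b.1 ∧ ∀ j, j ≠ κ → (b.1 - (M : ℤ) • z) j ≤ (M : ℤ) - 1) (Y : Site d × Fin d → Matrix n n ℂ) :
    ‖∑ b ∈ F, (Ad (gaugeAct (lcomb κ M W z) W b.1 b.2)⁻¹ (Y b) - Y b)‖
      ≤ 2 * (((d : ℝ) - 1) * ((M : ℝ) - 1) * a) * ∑ b ∈ F, ‖Y b‖ :=
  norm_sum_Ad_inv_sub_le F (fun b _ => isUnitaryCfg_lcombGauge hW κ z b.1 b.2)
    (fun b hb => norm_lcombGauge_sub_one_le hW hWa hM ha κ z (hF b hb).1 (hF b hb).2 b.2) Y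

end Small

/-! ## §5 The face transport and the exact form of (C4a) with `U = bseg M W` -/

/-- **THE FACE TRANSPORT IS THE STRAIGHT SEGMENT UP TO THE COMB-GAUGE BOND VARIABLE**: at a face site `x` of block `z` in direction
`κ` (`(x − M•z)_κ = M − 1`), `lcomb_z(x) · W(x,κ) · lcomb_{z+e_κ}(x+e_κ)⁻¹ = W^{lcomb_z}(x,κ) · bseg M W z κ` EXACTLY. [folklore] -/
theorem face_transport_eq (κ : Fin d) (M : ℕ) (W : Site d → Fin d → (Matrix n n ℂ)ˣ) (z : Site d) {x : Site d}
    (hx : (x - (M : ℤ) • z) κ = (M : ℤ) - 1) :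
    lcomb κ M W z x * W x κ * (lcomb κ M W (z + e κ) (x + e κ))⁻¹
      = gaugeAct (lcomb κ M W z) W x κ * bseg M W z κ := by
  have hM : (M : ℤ) ≤ (x + e κ - (M : ℤ) • z) κ := by
    have : (x + e κ - (M : ℤ) • z) κ = (x - (M : ℤ) • z) κ + 1 := by simp [e_apply]; ring
    rw [this, hx]; linarith
  simp only [gaugeAct]
  rw [lcomb_eq_bseg_mul_lcomb κ M W z hM]
  simp only [mul_inv_rev, mul_assoc, inv_mul_cancel, mul_one]

/-- **THE FACE PART OF THE COVARIANT DERIVATIVE OF THE TRANSPORTED CHARGES = THE TRANSPORTED COARSE GAUGE DIRECTION OF THE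
STRAIGHT-TRANSPORT CONFIGURATION, up to a comb-loop defect** (the exact form of the design's (C4a) «Jmp(D_U μ) = M²·face part»
with `U := bseg M W`): at a face site `x` of block `z` in direction `κ`, for coarse charges `μc` at the corners,
`Ad_{W(x,κ)⁻¹}(Ad_{lcomb_z(x)⁻¹} μc z) − Ad_{lcomb_{z′}(x+e_κ)⁻¹} μc z′
  = Ad_{lcomb_{z′}(x+e_κ)⁻¹} ( gaugeDir (bseg M W) μc (z,κ) + Ad_{bseg⁻¹}(Ad_{W^{lcomb_z}(x,κ)⁻¹} μc z − μc z) )`, `z′ = z + e_κ`.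
[folklore] -/
theorem face_gaugeDir_eq (κ : Fin d) (M : ℕ) (W : Site d → Fin d → (Matrix n n ℂ)ˣ) (z : Site d) {x : Site d}
    (hx : (x - (M : ℤ) • z) κ = (M : ℤ) - 1) (μc : Site d → Matrix n n ℂ) :
    Ad (W x κ)⁻¹ (Ad (lcomb κ M W z x)⁻¹ (μc z)) - Ad (lcomb κ M W (z + e κ) (x + e κ))⁻¹ (μc (z + e κ))
      = Ad (lcomb κ M W (z + e κ) (x + e κ))⁻¹
          (gaugeDir (bseg M W) μc z κ
            + Ad (bseg M W z κ)⁻¹ (Ad (gaugeAct (lcomb κ M W z) W x κ)⁻¹ (μc z) - μc z)) := by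
  have hkey : (W x κ)⁻¹ * (lcomb κ M W z x)⁻¹
      = (lcomb κ M W (z + e κ) (x + e κ))⁻¹ * ((bseg M W z κ)⁻¹ * (gaugeAct (lcomb κ M W z) W x κ)⁻¹) := by
    have h := face_transport_eq κ M W z hx
    have h2 : lcomb κ M W z x * W x κ = gaugeAct (lcomb κ M W z) W x κ * bseg M W z κ * lcomb κ M W (z + e κ) (x + e κ) := by
      rw [← h, inv_mul_cancel_right]
    have h3 : (W x κ)⁻¹ * (lcomb κ M W z x)⁻¹ = (lcomb κ M W z x * W x κ)⁻¹ := by rw [mul_inv_rev]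
    rw [h3, h2]
    simp only [mul_inv_rev, mul_assoc]
  rw [← Ad_mul, hkey, Ad_mul, Ad_mul, ← Ad_sub]
  congr 1
  simp only [gaugeDir, Ad_sub]
  abel

section FaceSmall

variable [Nonempty n] {M : ℕ} {W : Site d → Fin d → (Matrix n n ℂ)ˣ} (hW : IsUnitaryCfg W) {a : ℝ} (hWa : SmallField W a)
include hW hWa

/-- **THE FACE DEFECT IS COMB-SIZE**: at a face site `x` of block `z` (so `M•z ≤ x`, transverse residues `≤ M−1`,
`(x − M•z)_κ = M − 1`), the face part of the covariant derivative of the transported charges differs from the transported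
coarse gauge direction `gaugeDir (bseg M W) μc (z,κ)` of the straight-transport configuration by at most `2(d−1)(M−1)a·‖μc z‖`.
[folklore] -/
theorem norm_face_gaugeDir_sub_le (hM : 1 ≤ M) (ha : 0 ≤ a) (κ : Fin d) (z : Site d) {x : Site d} (hx : (M : ℤ) • z ≤ x)
    (hxt : ∀ j, j ≠ κ → (x - (M : ℤ) • z) j ≤ (M : ℤ) - 1) (hxκ : (x - (M : ℤ) • z) κ = (M : ℤ) - 1)
    (μc : Site d → Matrix n n ℂ) :
    ‖(Ad (W x κ)⁻¹ (Ad (lcomb κ M W z x)⁻¹ (μc z)) - Ad (lcomb κ M W (z + e κ) (x + e κ))⁻¹ (μc (z + e κ)))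
        - Ad (lcomb κ M W (z + e κ) (x + e κ))⁻¹ (gaugeDir (bseg M W) μc z κ)‖
      ≤ 2 * (((d : ℝ) - 1) * ((M : ℝ) - 1) * a) * ‖μc z‖ := by
  have hg := isUnitaryCfg_lcombGauge (M := M) hW κ z x κ
  rw [face_gaugeDir_eq κ M W z hxκ μc, AveragingDeficitNearIdentity.Ad_add, add_sub_cancel_left,
    norm_Ad_of_unitary ((unitaryUnits (Matrix n n ℂ)).inv_mem (lcomb_mem hW κ M (z + e κ) (x + e κ))),
    norm_Ad_of_unitary ((unitaryUnits (Matrix n n ℂ)).inv_mem (bseg_mem hW M z κ))]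
  refine (norm_Ad_sub_le ((unitaryUnits (Matrix n n ℂ)).inv_mem hg) _).trans ?_
  have h1 := (norm_inv_sub_one_le (mem_U1_of_unitary hg)).trans (norm_lcombGauge_sub_one_le hW hWa hM ha κ z hx hxt κ)
  have h0 : 0 ≤ ((d : ℝ) - 1) * ((M : ℝ) - 1) * a := (norm_nonneg _).trans h1
  gcongr

end FaceSmall

end

end Summit.QuantumFields.BalabanUV.T4Continuum.NE3CombGaugeLine
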